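import Summits.MatrixMultiplication.MatrixMultiplication.Theorems.FarEdgeDescentIsolatedCeiling
import Summits.MatrixMultiplication.MatrixMultiplication.Theorems.FarEdgeDescentIsolatedTower
import HarnessLib

/-!
# Far-edge descent, kernel XXXIII-C: the isolated towers have order EXACTLY `θ_S` — the sandwich

Route `FarEdgeDescent`, special leaf `FiniteSaturation` (stmt-MatrixMultiplication-23739): helper
kernel, THESES-FREE and def-free.  Kernel XXXIII-B (`FarEdgeDescentIsolatedCeiling.readout_of_wedge`)
proves that the readouts of any improvable squaring chain pass on a full wedge `s − 1 ≤ c(1−t)^κ`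
(`κ = log₂(4/3)`).  This file instantiates it on the certified isolated towers of kernel XXXII-C
(`isolatedTowerChain`), over every field `K`:

* `isolatedTower_readout_of_wedge` — EVERY isolated tower (any base gadget `⟨1,Q₀,1⟩ ⊕ ⨁⟨aᵢ,Bᵢ,aᵢ⟩`
  with `r₀ ≥ 2`, `3L₀ ≤ r₀`) has, next to its certificate property, the lower wedge — the order
  `θ_S = κ/(1−κ) = log(4/3)/log(3/2) = 0.70951…` of the method is base-independent (base census
  `∑ aᵢ^s Bᵢ^t ≤ L₀(1 + L₀(s−1))` by `rpow_le_linear`);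
* `isolatedTower_sandwich` — the `E₃` tower of record (`⟨1,4,1⟩ ⊕ ⟨3,1,3⟩`, `r₀ = 10`, `Q₀ = 4`,
  `L₀ = 3`, `G₀ = 3^s`; kernels XXXII-A…D) in one statement: (i) certificate — every sub-tangent of
  `y ↦ ω_K(1,y,1)` passes every readout; (ii) upper wedge (kernel XXXI-B) — sub-tangents lie in
  `s − 1 ≤ C(1−t)^κ` (= `RateBeyond θ` for all `θ < θ_S`, kernel XXXII-D); (iii) lower wedge — every
  `(s,t)` with `s − 1 ≤ c(1−t)^κ` passes every readout; (iv) the power world `x + 1 + M·x^(−θ_S)`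
  passes every readout.  By (iii)/(iv) these certificates cannot distinguish the truth from a world
  with `e(k) = ω(1,k,1) − (k+1) ≍ k^(−θ_S)`: the rate ladder of the lineage's instrument is CAPPED at
  `θ_S`, strictly short of `FiniteSaturation` — a theorem, no longer a remark (critic g17 on XXXII:
  «UNDECIDED, not a theorem»).  Numerically the pass boundary is `s − 1 ∼ 1.7802·(1−t)^κ`.

References: Schönhage 1981, §5; Pan 1984 (LNCS 179) §16 Props. 16.2–16.5, §17 Thm. 17.1; Stothers 2010,
Thm. 8; Knuth TAOCP 2, §4.6.4 Ex. 67(g); Lotti–Romani 1983, Prop. 4.1.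
Tags: `FiniteSaturation` (h₁) NEC · WEAKER · ATTACKED; instrument ceiling `θ_S` = THEOREM.
-/

set_option linter.dupNamespace false

noncomputable section

open scoped BigOperators Polynomial
open Polynomial

namespace Summit.MatrixMultiplication.MatrixMultiplication.Theorems.FarEdgeDescentIsolatedSandwich

open Literature.Computability.AlgebraicComplexity
open Summit.MatrixMultiplication.MatrixMultiplication.Theorems.FarEdgeDescentImprovableRate
open Summit.MatrixMultiplication.MatrixMultiplication.Theorems.FarEdgeDescentIsolatedChain
open Summit.MatrixMultiplication.MatrixMultiplication.Theorems.FarEdgeDescentIsolatedTower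
open Summit.MatrixMultiplication.MatrixMultiplication.Theorems.FarEdgeDescentCeilingSteps
open Summit.MatrixMultiplication.MatrixMultiplication.Theorems.FarEdgeDescentIsolatedCeiling

variable (K : Type) [Field K]

/-- **The ceiling holds for EVERY isolated tower, whatever its base.**  For every isolated-anchor
base `⟨1,Q₀,1⟩ ⊕ ⨁ᵢ⟨aᵢ,Bᵢ,aᵢ⟩` of length `r₀ = Q₀ + 2∑aᵢBᵢ ≥ 2` with `3∑aᵢBᵢ ≤ r₀` (kernel XXXII-C
`isolatedTowerChain`), the certified squaring tower it starts has — next to its certificate property —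
a full `κ`-wedge on which every readout passes (base census `∑ aᵢ^s Bᵢ^t ≤ L₀(1 + L₀(s−1))`,
`rpow_le_linear`).  So the order `θ_S` of the method does not depend on the base gadget.
[cite: Pan1984, Props. 16.2–16.5] [cite: Stothers2010, Thm. 8] [cite: KnuthTAOCP2, §4.6.4, Ex. 67(g)] -/
theorem isolatedTower_readout_of_wedge {p₀ : ℕ} (a₀ B₀ : Fin p₀ → ℕ) (ha₀ : ∀ i, 2 ≤ a₀ i)
    (hB₀ : ∀ i, 1 ≤ B₀ i) {Q₀ r₀ h₀ : ℕ} (hQ₀ : 1 ≤ Q₀) (hsum₀ : Q₀ + 2 * ∑ i, a₀ i * B₀ i = r₀)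
    (hr₀ : 2 ≤ r₀) (hm₀ : 3 * ∑ i, a₀ i * B₀ i ≤ r₀)
    (hinv₀ : ∃ (u : Fin r₀ → _ → K[X]) (v : Fin r₀ → _ → K[X]) (w : Fin r₀ → _ → K[X])
      (d : Fin r₀ → K[X]),
      IsApproxDecomposition h₀ (matMulDirectSum K (Fin.cons 1 a₀) (Fin.cons Q₀ B₀) (Fin.cons 1 a₀))
        u v w ∧ (∀ s, d s ≠ 0) ∧ ∀ b c, ¬ (b.1 = 0 ∧ c.1 = 0) → ∑ s, d s * v s b * w s c = 0) :
    ∃ (r Q L : ℕ → ℕ) (G : ℕ → ℝ → ℝ → ℝ),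
      r 0 = r₀ ∧ Q 0 = Q₀ ∧ L 0 = ∑ i, a₀ i * B₀ i ∧
      (∀ s t : ℝ, G 0 s t = ∑ i, ((a₀ i : ℕ) : ℝ) ^ s * ((B₀ i : ℕ) : ℝ) ^ t) ∧
      (∀ j, Q j + 2 * L j = r j) ∧ (∀ j, L (j + 1) = (Q j + L j) ^ 2 - Q j ^ 2) ∧
      (∀ j, r (j + 1) = r j ^ 2) ∧
      (∀ j (s t : ℝ), G (j + 1) s t =
        (((Q j : ℕ) : ℝ) ^ t + G j s t) ^ 2 - (((Q j : ℕ) : ℝ) ^ t) ^ 2) ∧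
      (∀ j (s t : ℝ), (∀ y : ℝ, 0 ≤ y → s + y * t ≤ omegaRect K 1 y 1) → G j s t ≤ r j) ∧
      (∃ c : ℝ, 0 < c ∧ ∀ s t : ℝ, 1 ≤ s → 0 ≤ t → t ≤ 1 →
        s - 1 ≤ c * (1 - t) ^ Real.logb 2 ((4 : ℝ) / 3) → ∀ j, G j s t ≤ (r j : ℝ) / 2) := by
  obtain ⟨r, Q, L, G, h0r, h0Q, h0L, h0G, hsum, hQ1, hL, hr, hG, hread⟩ :=
    isolatedTowerChain K a₀ B₀ ha₀ hB₀ hQ₀ hsum₀ hinv₀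
  have hr0 : 2 ≤ r 0 := by rw [h0r]; exact hr₀
  have hm0 : 3 * L 0 ≤ r 0 := by rw [h0L, h0r]; exact hm₀
  have hG0 : ∀ s t : ℝ, 0 ≤ G 0 s t := by
    intro s t
    rw [h0G]
    exact Finset.sum_nonneg fun _ _ =>
      mul_nonneg (Real.rpow_nonneg (Nat.cast_nonneg _) _) (Real.rpow_nonneg (Nat.cast_nonneg _) _)
  -- base census, linear in s − 1 with slope D = L₀
  have hUp : ∀ s t : ℝ, 1 ≤ s → s ≤ 2 → t ≤ 1 →
      G 0 s t ≤ (L 0 : ℝ) * (1 + ((∑ i, a₀ i * B₀ i : ℕ) : ℝ) * (s - 1)) := by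
    intro s t hs1 hs2 ht1
    rw [h0G, h0L]
    have hσ : 0 ≤ s - 1 := by linarith
    have hterm : ∀ i, ((a₀ i : ℕ) : ℝ) ^ s * ((B₀ i : ℕ) : ℝ) ^ t ≤
        (((a₀ i * B₀ i : ℕ)) : ℝ) * (1 + ((∑ i, a₀ i * B₀ i : ℕ) : ℝ) * (s - 1)) := by
      intro i
      have ha1 : (1 : ℝ) ≤ ((a₀ i : ℕ) : ℝ) := by exact_mod_cast (le_trans (by norm_num) (ha₀ i))
      have hB1 : (1 : ℝ) ≤ ((B₀ i : ℕ) : ℝ) := by exact_mod_cast hB₀ i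
      have haL : ((a₀ i : ℕ) : ℝ) - 1 ≤ ((∑ i, a₀ i * B₀ i : ℕ) : ℝ) := by
        have h1 : a₀ i ≤ a₀ i * B₀ i := Nat.le_mul_of_pos_right _ (hB₀ i)
        have h2 : a₀ i * B₀ i ≤ ∑ j, a₀ j * B₀ j :=
          Finset.single_le_sum (f := fun j => a₀ j * B₀ j) (fun j _ => Nat.zero_le _)
            (Finset.mem_univ i)
        have h3 : ((a₀ i : ℕ) : ℝ) ≤ ((∑ i, a₀ i * B₀ i : ℕ) : ℝ) := by exact_mod_cast h1.trans h2
        linarith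
      have hpa := rpow_le_linear ha1 hs1 hs2
      have hpB := FarEdgeDescentVirtualPoint.anchor_rpow_le ht1 (hB₀ i)
      have hBt0 : 0 ≤ ((B₀ i : ℕ) : ℝ) ^ t := Real.rpow_nonneg (by linarith) t
      have ha0 : 0 ≤ ((a₀ i : ℕ) : ℝ) := by linarith
      have hlin : ((a₀ i : ℕ) : ℝ) * (1 + (((a₀ i : ℕ) : ℝ) - 1) * (s - 1)) ≤
          ((a₀ i : ℕ) : ℝ) * (1 + ((∑ i, a₀ i * B₀ i : ℕ) : ℝ) * (s - 1)) :=
        mul_le_mul_of_nonneg_left (by nlinarith) ha0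
      calc ((a₀ i : ℕ) : ℝ) ^ s * ((B₀ i : ℕ) : ℝ) ^ t
          ≤ ((a₀ i : ℕ) : ℝ) * (1 + ((∑ i, a₀ i * B₀ i : ℕ) : ℝ) * (s - 1)) * ((B₀ i : ℕ) : ℝ) :=
            mul_le_mul (hpa.trans hlin) hpB hBt0 (by positivity)
        _ = (((a₀ i * B₀ i : ℕ)) : ℝ) * (1 + ((∑ i, a₀ i * B₀ i : ℕ) : ℝ) * (s - 1)) := by
            push_cast; ring
    calc (∑ i, ((a₀ i : ℕ) : ℝ) ^ s * ((B₀ i : ℕ) : ℝ) ^ t)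
        ≤ ∑ i, (((a₀ i * B₀ i : ℕ)) : ℝ) * (1 + ((∑ i, a₀ i * B₀ i : ℕ) : ℝ) * (s - 1)) :=
          Finset.sum_le_sum fun i _ => hterm i
      _ = ((∑ i, a₀ i * B₀ i : ℕ) : ℝ) * (1 + ((∑ i, a₀ i * B₀ i : ℕ) : ℝ) * (s - 1)) := by
          rw [← Finset.sum_mul]; push_cast; rfl
  obtain ⟨c, hc0, -, hW⟩ := readout_of_wedge r Q L G hr0 hsum hQ1 hm0 hL hr hG0 hG
    (D := ((∑ i, a₀ i * B₀ i : ℕ) : ℝ)) (by positivity) hUp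
  exact ⟨r, Q, L, G, h0r, h0Q, h0L, h0G, hsum, hL, hr, hG, hread, c, hc0, hW⟩

/-- **THE ISOLATED `E₃` TOWER HAS ORDER EXACTLY `θ_S = log(4/3)/log(3/2) = 0.70951…`.**  Over every
field `K`, the certified isolated-anchor improvable squaring tower on Schönhage's `E₃`
(`⟨1,4,1⟩ ⊕ ⟨3,1,3⟩`, `r₀ = 10`, `Q₀ = 4`, `L₀ = 3`, `G₀(s,t) = 3^s`; kernels XXXII-A…D) satisfies, with
`κ = log₂(4/3)`:
(i) CERTIFICATE — every sub-tangent `(s,t)` of `y ↦ ω_K(1,y,1)` passes every readout `G_j(s,t) ≤ r_j`;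
(ii) UPPER WEDGE (kernel XXXI-B) — hence every sub-tangent with `0 ≤ t ≤ 1 ≤ s ≤ 2` has
`s − 1 ≤ C(1−t)^κ`, which is `RateBeyond θ` for all `θ < θ_S`;
(iii) LOWER WEDGE (this kernel) — every `(s,t)` with `s − 1 ≤ c(1−t)^κ` passes every readout;
(iv) the POWER WORLD `x + 1 + M·x^(−θ_S)` passes every readout.
By (iii)/(iv) the readouts cannot distinguish the truth from a world with `e(k) ≍ k^(−θ_S)`: the
rate ladder built on these certificates is capped at `θ_S`, strictly short of `FiniteSaturation`.
[cite: Schonhage1981, §5] [cite: Pan1984, §16 Props. 16.2–16.5, §17 Thm. 17.1]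
[cite: Stothers2010, Thm. 8] [cite: KnuthTAOCP2, §4.6.4, Ex. 67(g)] [cite: LottiRomani1983, Prop. 4.1] -/
theorem isolatedTower_sandwich :
    ∃ (r Q L : ℕ → ℕ) (G : ℕ → ℝ → ℝ → ℝ),
      r 0 = 10 ∧ Q 0 = 4 ∧ L 0 = 3 ∧ (∀ s t : ℝ, G 0 s t = (3 : ℝ) ^ s) ∧
      (∀ j, Q j + 2 * L j = r j) ∧ (∀ j, L (j + 1) = (Q j + L j) ^ 2 - Q j ^ 2) ∧
      (∀ j, r (j + 1) = r j ^ 2) ∧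
      (∀ j (s t : ℝ), G (j + 1) s t =
        (((Q j : ℕ) : ℝ) ^ t + G j s t) ^ 2 - (((Q j : ℕ) : ℝ) ^ t) ^ 2) ∧
      (∀ j (s t : ℝ), (∀ y : ℝ, 0 ≤ y → s + y * t ≤ omegaRect K 1 y 1) → G j s t ≤ r j) ∧
      (∃ C : ℝ, 0 ≤ C ∧ ∀ s t : ℝ, 0 ≤ t → t ≤ 1 → 1 ≤ s → s ≤ 2 →
        (∀ y : ℝ, 0 ≤ y → s + y * t ≤ omegaRect K 1 y 1) →
        s - 1 ≤ C * (1 - t) ^ Real.logb 2 ((4 : ℝ) / 3)) ∧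
      (∃ c : ℝ, 0 < c ∧ ∀ s t : ℝ, 1 ≤ s → 0 ≤ t → t ≤ 1 →
        s - 1 ≤ c * (1 - t) ^ Real.logb 2 ((4 : ℝ) / 3) → ∀ j, G j s t ≤ (r j : ℝ) / 2) ∧
      (∃ M : ℝ, 0 < M ∧ ∀ s t : ℝ, 1 ≤ s → 0 ≤ t → t < 1 →
        (∀ x : ℝ, 0 < x → s + x * t ≤ x + 1 +
          M * x ^ (-(Real.logb 2 ((4 : ℝ) / 3) / (1 - Real.logb 2 ((4 : ℝ) / 3))))) →
        ∀ j, G j s t ≤ (r j : ℝ) / 2) := by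
  obtain ⟨H, u, v, w, d, hreal, hd, himp⟩ := base_isolated K
  obtain ⟨r, Q, L, G, h0r, h0Q, h0L, h0G, hsum, hQ1, hL, hr, hG, hread⟩ :=
    isolatedTowerChain K (fun _ : Fin 1 => 3) (fun _ : Fin 1 => 1) (fun _ => by norm_num)
      (fun _ => le_rfl) (Q₀ := 4) (by norm_num) (by simp) ⟨u, v, w, d, hreal, hd, himp⟩
  have h0L' : L 0 = 3 := by rw [h0L]; simp
  have h0G' : ∀ s t : ℝ, G 0 s t = (3 : ℝ) ^ s := by
    intro s t
    rw [h0G]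
    simp
  have hr0 : 2 ≤ r 0 := by rw [h0r]; norm_num
  have hm0 : 3 * L 0 ≤ r 0 := by rw [h0L', h0r]; norm_num
  have hG0 : ∀ s t : ℝ, 0 ≤ G 0 s t := fun s t => by rw [h0G']; positivity
  have hUp : ∀ s t : ℝ, 1 ≤ s → s ≤ 2 → t ≤ 1 → G 0 s t ≤ (L 0 : ℝ) * (1 + 2 * (s - 1)) := by
    intro s t hs1 hs2 _
    rw [h0G', h0L']
    push_cast
    exact rpow_three_le hs1 hs2
  refine ⟨r, Q, L, G, h0r, h0Q, h0L', h0G', hsum, hL, hr, hG, hread, ?_, ?_,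
    readout_of_powerWorld r Q L G hr0 hsum hQ1 hm0 hL hr hG0 hG (D := 2) (by norm_num) hUp⟩
  · refine virtualPowerBound_of_improvableChain K r Q L G hr0 hsum hQ1 hm0 hL hr hG0 hG hread
      (c := 3 / 10) (by norm_num) ?_
    intro s t _ _ hs1 _ _
    rw [h0G', h0L', h0r]
    push_cast
    have h3 := three_mul_le_rpow hs1
    linarith
  · obtain ⟨c, hc0, -, hW⟩ :=
      readout_of_wedge r Q L G hr0 hsum hQ1 hm0 hL hr hG0 hG (D := 2) (by norm_num) hUp
    exact ⟨c, hc0, hW⟩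

end Summit.MatrixMultiplication.MatrixMultiplication.Theorems.FarEdgeDescentIsolatedSandwich

end
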